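import Literature.Barriers.CriticalPhenomena.KozmaNachmiasE1
import Literature.Barriers.CriticalPhenomena.KozmaNachmiasTwoPointSums
import Literature.Probability.Percolation.ReimerLocalFinitary
import HarnessLib

/-!
# Kozma–Nachmias 2011, Lemma 5.2: `E[Y² ; X^{K-reg} = M] ≤ C M² L⁴ P(X^{K-reg} = M)` PROVED

Barrier catalogue `Literature/Barriers/CriticalPhenomena/` (D-0021), programme for the named fact
`KozmaNachmias2011_thm2` (Theorem 2 of Kozma–Nachmias 2011). Lemma 5.2 (p. 398) is the second-moment
bound of the Paley–Zygmund argument of Chapter 5: for the number `Y = Y(j, L, K)` of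
`(j, L, K)`-admissible pairs (`admissibleCount`, `KozmaNachmiasAdmissible.lean`),

> **Lemma 5.2.** `E Y²(j, L, K) 1_{X_j^{K-reg} = M} ≤ C M² L⁴ P(X_j^{K-reg} = M)`

(the printed proof ends "since `M ≥ L²/2`", which is the only range in which it is used; we carry
this hypothesis). We prove it in the summed form in which it is used,
`Σ_{(x₁,y₁),(x₂,y₂)} P((x₁,y₁), (x₂,y₂) admissible, X^{K-reg} = M) ≤ C M² L⁴ P(X^{K-reg} = M)`
(`KozmaNachmias2011_lemma52_sum`; the identification with `E[Y²; X^{reg} = M]` is the counting identity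
of the assembly file), following the printed proof (pp. 405–406):

* **the trichotomy** (p. 405, (i)–(iii)): if `(x, y₁)` and `(x, y₂)` are admissible and
  `X^{reg} = M`, then `E₁(x) ∘ {x ↔ z} ∘ {z ↔ y₁} ∘ {z ↔ y₂}` occurs for some `z` (the triple point
  of `x̃, y₁, y₂` in the cluster `C̃` "of all vertices connected to `0` only through `(x, x̃)`",
  which is disjoint from `C(0; Q_j)`; case (i) `y₁ = y₂` is the instance `z = y₁`), and if
  `x₁ ≠ x₂` then `{E₁(x₁), E₁(x₂)} ∘ {x₁ ↔ y₁} ∘ {x₂ ↔ y₂}` occurs (the clusters `C̃₁, C̃₂` are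
  disjoint) — `admissible_inter_subset_iUnion`, `admissible_inter_subset_of_ne`, with the
  witnesses built from open paths (`exists_triple_witness`) and the saturation of `E₁`
  (`localCylinder_clusterPairs_subset_eventE1`);
* **BK–Reimer** in the form `reimer_local_finitary_list` (`E₁` is local but not monotone; the
  connections are finitary increasing), giving the sums `S₁ + S₂` and `S₃` of p. 405;
* the two-point sums `Σ_z τ(x,z) (Σ_{y ∈ x+Q_L} τ(z,y))² ≤ C L⁶` ("using Lemma 2.1") and
  `Σ_{y ∈ x+Q_L} τ(x,y) ≤ C L²` (`KozmaNachmiasTwoPointSums.lean`), and the counting identities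
  `Σ_x P(E₁(x)) = M P(X^{reg} = M)`, `Σ_{x₁,x₂} P(E₁(x₁) ∩ E₁(x₂)) = M² P(X^{reg} = M)` (`KozmaNachmiasE1.lean`).

The statement is proved for every `p` under the upper two-point bound `τ_p(x,y) ≤ C/‖x-y‖^{d-2}`
(`d ≥ 4`), and specialised to `p = p_c` under `TwoPointBoundedRatio d`.

## References

* G. Kozma, A. Nachmias, *Arm exponents in high dimensional percolation*, J. Amer. Math. Soc. 24
  (2011) 375–409: Lemma 5.2 (p. 398) and its proof (pp. 405–406); admissible pairs (p. 398).
* G. Grimmett, *Percolation*, 2nd ed. 1999, §2.3 (BK and Reimer inequalities).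
-/

noncomputable section

namespace Literature.Barriers.CriticalPhenomena

open _root_.MeasureTheory _root_.Filter _root_.Topology Finset Literature.Probability.LatticeModels
  Literature.Probability.Percolation Literature.Probability.Percolation.DCT16
open scoped Literature.Probability.LatticeModels Literature.Probability.Percolation

/-! ### Open witnesses from open paths -/

section Witness

variable {V : Type*}

/-- **Finite open witness of a connection, with located endpoints**: an open path inside `T` from
`u` to `v` yields a finite set of open edges, all with both endpoints in `T` and joined to `u`,
which by itself joins `u` to `v`. [folklore] -/
theorem exists_finset_of_pathIn {ω : BondConfig V} {T : Set V} {u v : V}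
    (h : PathIn (openGraph ω) T u v) :
    ∃ E : Finset (Sym2 V), (↑E : Set (Sym2 V)) ⊆ ω ∧
      (∀ e ∈ E, ∀ w ∈ e, w ∈ T ∧ (openGraph ω).Reachable u w) ∧
      (↑E : Set (Sym2 V)) ∈ (openConn u v : Set (BondConfig V)) := by
  classical
  obtain ⟨hu, hr⟩ := h
  induction hr with
  | refl => exact ⟨∅, by simp, by simp, SimpleGraph.Reachable.refl _⟩
  | @tail b c hub hbc ih =>
    obtain ⟨E, hEω, hET, hEconn⟩ := ih
    have hb : PathIn (openGraph ω) T u b := ⟨hu, hub⟩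
    have hadj := (openGraph_adj ω b c).1 hbc.1
    refine ⟨insert s(b, c) E, ?_, ?_, ?_⟩
    · rw [Finset.coe_insert]
      exact Set.insert_subset hadj.1 hEω
    · intro e he w hw
      rcases Finset.mem_insert.1 he with rfl | he
      · rcases Sym2.mem_iff.1 hw with rfl | rfl
        · exact ⟨hb.right_mem, reachable_of_pathIn hb⟩
        · exact ⟨hbc.2, (reachable_of_pathIn hb).trans hbc.1.reachable⟩
      · exact hET e he w hw
    · have h1 : (openGraph (↑(insert s(b, c) E) : Set (Sym2 V))).Reachable u b :=
        hEconn.mono (openGraph_mono (by rw [Finset.coe_insert]; exact Set.subset_insert _ _))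
      refine h1.trans (SimpleGraph.Adj.reachable ((openGraph_adj _ b c).2 ⟨?_, hadj.2⟩))
      simp

/-- **Finite open witness of `{u ↔ v}`** with all endpoints joined to `u`. [folklore] -/
theorem exists_finset_witness_openConn {ω : BondConfig V} {u v : V}
    (h : (openGraph ω).Reachable u v) :
    ∃ E : Finset (Sym2 V), (↑E : Set (Sym2 V)) ⊆ ω ∧
      (∀ e ∈ E, ∀ w ∈ e, (openGraph ω).Reachable u w) ∧
      (↑E : Set (Sym2 V)) ∈ (openConn u v : Set (BondConfig V)) := by
  obtain ⟨E, h1, h2, h3⟩ := exists_finset_of_pathIn (DCT16.pathIn_univ_of_reachable h)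
  exact ⟨E, h1, fun e he w hw => (h2 e he w hw).2, h3⟩

/-- The edges of an open walk, as a finite configuration, are open, have endpoints on the walk, and
join its ends. [folklore] -/
theorem walk_edges_witness [DecidableEq V] {ω : BondConfig V} {u v : V} (q : (openGraph ω).Walk u v) :
    (↑q.edges.toFinset : Set (Sym2 V)) ⊆ ω ∧
      (∀ e ∈ q.edges.toFinset, ∀ w ∈ e, w ∈ q.support) ∧
      (↑q.edges.toFinset : Set (Sym2 V)) ∈ (openConn u v : Set (BondConfig V)) := by
  refine ⟨fun e he => mem_of_mem_walk_edges q (List.mem_toFinset.1 he), fun e he w hw =>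
    q.mem_support_of_mem_edges (List.mem_toFinset.1 he) hw, ?_⟩
  exact reachable_openGraph_of_walk q fun e he => by simp [he]

/-- **The triple point** (Kozma–Nachmias 2011, p. 405: "one may define `z` to be the triple point of
`x̃₁, y₁` and `y₂` in `C̃` in the usual way"): if `u ↔ y₁` and `u ↔ y₂` in `ω`, there are a vertex `z`
and three pairwise disjoint finite sets of open edges, all of whose endpoints are joined to `u`,
witnessing `u ↔ z`, `z ↔ y₁` and `z ↔ y₂` respectively. (Take a simple open path `α` from `u` to
`y₁`, and an open path from `y₂` stopped at its first vertex `z` on `α`; split `α` at `z`.)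
[cite: KozmaNachmias2011, proof of Lemma 5.2 ((ii), p. 405)] -/
theorem exists_triple_witness [DecidableEq V] {ω : BondConfig V} {u y₁ y₂ : V}
    (h₁ : (openGraph ω).Reachable u y₁) (h₂ : (openGraph ω).Reachable u y₂) :
    ∃ (z : V) (E₀ E₁ E₂ : Finset (Sym2 V)),
      (↑E₀ : Set (Sym2 V)) ⊆ ω ∧ (↑E₁ : Set (Sym2 V)) ⊆ ω ∧ (↑E₂ : Set (Sym2 V)) ⊆ ω ∧
      (∀ e ∈ E₀ ∪ E₁ ∪ E₂, ∀ w ∈ e, (openGraph ω).Reachable u w) ∧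
      Disjoint E₀ E₁ ∧ Disjoint E₀ E₂ ∧ Disjoint E₁ E₂ ∧
      (↑E₀ : Set (Sym2 V)) ∈ (openConn u z : Set (BondConfig V)) ∧
      (↑E₁ : Set (Sym2 V)) ∈ (openConn z y₁ : Set (BondConfig V)) ∧
      (↑E₂ : Set (Sym2 V)) ∈ (openConn z y₂ : Set (BondConfig V)) := by
  classical
  set G := openGraph ω with hG
  obtain ⟨α₀⟩ := h₁
  set α : G.Walk u y₁ := α₀.bypass with hα
  have hαpath : α.IsPath := α₀.bypass_isPath
  -- the first vertex on `α` of an open path from `y₂`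
  obtain ⟨z, hz, E₂, hE₂ω, hE₂reach, hE₂off, hE₂conn⟩ : ∃ z : V, ∃ hz : z ∈ α.support,
      ∃ E₂ : Finset (Sym2 V), (↑E₂ : Set (Sym2 V)) ⊆ ω ∧
        (∀ e ∈ E₂, ∀ w ∈ e, G.Reachable u w) ∧ (∀ e ∈ E₂, ∃ w ∈ e, w ∉ α.support) ∧
        (↑E₂ : Set (Sym2 V)) ∈ (openConn z y₂ : Set (BondConfig V)) := by
    by_cases hy₂ : y₂ ∈ α.support
    · exact ⟨y₂, hy₂, ∅, by simp, by simp, by simp, SimpleGraph.Reachable.refl _⟩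
    · have hβ : PathIn G Set.univ y₂ u := DCT16.pathIn_univ_of_reachable h₂.symm
      obtain ⟨a, b, haR, hbR, -, hab, hpath⟩ :=
        hβ.exit (R := {w | w ∉ α.support}) hy₂ (fun h => h α.start_mem_support)
      have hb : b ∈ α.support := by simpa using hbR
      obtain ⟨E, hEω, hET, hEconn⟩ := exists_finset_of_pathIn hpath
      have hadj := (openGraph_adj ω a b).1 hab
      refine ⟨b, hb, insert s(a, b) E, ?_, ?_, ?_, ?_⟩
      · rw [Finset.coe_insert]; exact Set.insert_subset hadj.1 hEω
      · intro e he w hw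
        rcases Finset.mem_insert.1 he with rfl | he
        · rcases Sym2.mem_iff.1 hw with rfl | rfl
          · exact h₂.trans (reachable_of_pathIn hpath)
          · exact h₂.trans ((reachable_of_pathIn hpath).trans hab.reachable)
        · exact h₂.trans (hET e he w hw).2
      · intro e he
        rcases Finset.mem_insert.1 he with rfl | he
        · exact ⟨a, Sym2.mem_mk_left _ _, haR⟩
        · induction e using Sym2.ind with
          | h a' b' => exact ⟨a', Sym2.mem_mk_left _ _, (hET _ he a' (Sym2.mem_mk_left _ _)).1.1⟩
      · -- `{ab} ∪ E` joins `b` to `y₂`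
        have h1 : (openGraph (↑(insert s(a, b) E) : Set (Sym2 V))).Reachable y₂ a :=
          hEconn.mono (openGraph_mono (by rw [Finset.coe_insert]; exact Set.subset_insert _ _))
        have h2 : (openGraph (↑(insert s(a, b) E) : Set (Sym2 V))).Adj a b :=
          (openGraph_adj _ a b).2 ⟨by simp, hadj.2⟩
        exact (h1.trans h2.reachable).symm
  -- split `α` at `z`
  set E₀ := (α.takeUntil z hz).edges.toFinset with hE₀
  set E₁ := (α.dropUntil z hz).edges.toFinset with hE₁
  obtain ⟨hE₀ω, hE₀supp, hE₀conn⟩ := walk_edges_witness (α.takeUntil z hz)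
  obtain ⟨hE₁ω, hE₁supp, hE₁conn⟩ := walk_edges_witness (α.dropUntil z hz)
  have hsub₀ : ∀ e ∈ E₀, e ∈ α.edges := fun e he =>
    α.edges_takeUntil_subset_edges hz (List.mem_toFinset.1 he)
  have hsub₁ : ∀ e ∈ E₁, e ∈ α.edges := fun e he =>
    α.edges_dropUntil_subset_edges hz (List.mem_toFinset.1 he)
  have hreachα : ∀ e ∈ α.edges, ∀ w ∈ e, G.Reachable u w := fun e he w hw =>
    (α.takeUntil w (α.mem_support_of_mem_edges he hw)).reachable
  -- disjointness of the two halves of the simple path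
  have hnodup : (α.takeUntil z hz).edges ++ (α.dropUntil z hz).edges = α.edges := by
    rw [← SimpleGraph.Walk.edges_append, α.take_spec hz]
  have hdisj₀₁ : Disjoint E₀ E₁ := by
    have h := hαpath.isTrail.edges_nodup
    rw [← hnodup, List.nodup_append] at h
    rw [hE₀, hE₁, Finset.disjoint_left]
    intro e he₀ he₁
    exact h.2.2 e (List.mem_toFinset.1 he₀) e (List.mem_toFinset.1 he₁) rfl
  have hdisjα₂ : ∀ E : Finset (Sym2 V), (∀ e ∈ E, e ∈ α.edges) → Disjoint E E₂ := by
    intro E hE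
    rw [Finset.disjoint_left]
    intro e he he₂
    obtain ⟨w, hw, hwoff⟩ := hE₂off e he₂
    exact hwoff (α.mem_support_of_mem_edges (hE e he) hw)
  refine ⟨z, E₀, E₁, E₂, hE₀ω, hE₁ω, hE₂ω, ?_, hdisj₀₁, hdisjα₂ E₀ hsub₀, hdisjα₂ E₁ hsub₁,
    hE₀conn, hE₁conn, hE₂conn⟩
  intro e he w hw
  rcases Finset.mem_union.1 he with he | he
  · rcases Finset.mem_union.1 he with he | he
    · exact hreachα e (hsub₀ e he) w hw
    · exact hreachα e (hsub₁ e he) w hw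
  · exact hE₂reach e he w hw

end Witness

/-! ### Consequences of admissibility: the cluster `C̃` behind `x̃` -/

section AdmissibleFacts

variable {d : ℕ} {p : unitInterval} {j L K : ℕ} {x y : Site d} {ω : BondConfig (Site d)}

/-- For an admissible pair the edge `(x, x̃)` is open and closing it separates `0` from `y`.
[cite: KozmaNachmias2011, §5 (admissible pairs, p. 398)] -/
theorem IsAdmissible.edge_mem_and_not (h : IsAdmissible p j L K x y ω) :
    s(x, outerNeighbor j x) ∈ ω ∧ ω \ {s(x, outerNeighbor j x)} ∉ (openConn (0 : Site d) y : Set _) :=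
  mem_and_notMem_of_isPivotal (isUpperSet_openConn 0 y) h.mem_openConn h.2.2.2.2.2.2

/-- `0 ↔ x` survives the closing of `(x, x̃)` (the path inside `Q_j` does not use it).
[cite: KozmaNachmias2011, proof of Lemma 5.2 (p. 405)] -/
theorem IsAdmissible.reachable_zero_diff (h : IsAdmissible p j L K x y ω) :
    (openGraph (ω \ {s(x, outerNeighbor j x)})).Reachable 0 x :=
  reachable_diff_of_openConnIn h.2.2.2.1 fun e he => by
    rw [Set.mem_singleton_iff] at he
    subst he
    exact ⟨outerNeighbor j x, Sym2.mem_mk_right _ _, fun h' => h.outerNeighbor_notMem_box (Finset.mem_coe.1 h')⟩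

/-- **`y ∈ C̃`**: for an admissible pair, `y ↔ x̃` with the edge `(x, x̃)` closed ("`y` is in the
cluster connected to `0` only through `(x, x̃)`", Kozma–Nachmias 2011, p. 405).
[cite: KozmaNachmias2011, proof of Lemma 5.2 (p. 405)] -/
theorem IsAdmissible.reachable_outer_diff (h : IsAdmissible p j L K x y ω) :
    (openGraph (ω \ {s(x, outerNeighbor j x)})).Reachable (outerNeighbor j x) y := by
  obtain ⟨he, hnot⟩ := h.edge_mem_and_not
  have hω : (openGraph (insert s(x, outerNeighbor j x) (ω \ {s(x, outerNeighbor j x)}))).Reachable y 0 := by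
    rw [Set.insert_sdiff_self_of_mem he]; exact h.mem_openConn.symm
  rcases reachable_insert_cases hω with h1 | ⟨h2, -⟩ | ⟨h3, -⟩
  · exact absurd h1.symm hnot
  · exact absurd (h.reachable_zero_diff.trans h2.symm) hnot
  · exact h3.symm

/-- **`C̃ ∩ C(x; Q_j) = ∅`** (Kozma–Nachmias 2011, p. 405: "Since `x̃₁ ∉ Q_j` we see that
`C̃ ∩ C(0; Q_j) = ∅`"): a vertex joined to `x̃` with `(x, x̃)` closed is not in `C(x; Q_j)`.
[cite: KozmaNachmias2011, proof of Lemma 5.2 (p. 405)] -/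
theorem IsAdmissible.notMem_clusterIn (h : IsAdmissible p j L K x y ω) {v : Site d}
    (hv : (openGraph (ω \ {s(x, outerNeighbor j x)})).Reachable (outerNeighbor j x) v) :
    v ∉ clusterIn (box d j) x ω := by
  intro hvC
  obtain ⟨-, hnot⟩ := h.edge_mem_and_not
  have hxv : (openGraph (ω \ {s(x, outerNeighbor j x)})).Reachable x v :=
    reachable_diff_of_openConnIn (mem_clusterIn.1 hvC) fun e he => by
      rw [Set.mem_singleton_iff] at he
      subst he
      exact ⟨outerNeighbor j x, Sym2.mem_mk_right _ _, fun h' => h.outerNeighbor_notMem_box (Finset.mem_coe.1 h')⟩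
  exact hnot ((h.reachable_zero_diff.trans hxv).trans (hv.symm.trans h.reachable_outer_diff))

/-- The edge `(x, x̃)` is not a pair of `Q_j`. [folklore] -/
theorem IsAdmissible.edge_notMem_sym2 (h : IsAdmissible p j L K x y ω) :
    s(x, outerNeighbor j x) ∉ (box d j).sym2 := fun he =>
  h.outerNeighbor_notMem_box (Finset.mk_mem_sym2_iff.1 he).2

/-- An edge whose endpoints avoid `C(x; Q_j)` is not a conditioned pair. [folklore] -/
theorem notMem_clusterPairs_of_forall {S C : Finset (Site d)} {e : Sym2 (Site d)}
    (he : ∀ w ∈ e, w ∉ C) : e ∉ clusterPairs S C := by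
  induction e using Sym2.ind with
  | h a b =>
    intro hmem
    simp only [clusterPairs, Finset.mem_sdiff, Finset.mk_mem_sym2_iff] at hmem
    obtain ⟨⟨ha, hb⟩, h2⟩ := hmem
    exact h2 ⟨⟨ha, he a (Sym2.mem_mk_left _ _)⟩, hb, he b (Sym2.mem_mk_right _ _)⟩

end AdmissibleFacts

/-! ### The trichotomy of the proof of Lemma 5.2 -/

section Trichotomy

variable {d : ℕ} (p : unitInterval) (j L K M : ℕ)

/-- **Cases (i)–(ii)** (Kozma–Nachmias 2011, p. 405): if `(x, y₁)` and `(x, y₂)` are admissible and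
`X_j^{K-reg} = M`, then for some `z` the events `E₁(x)`, `{x ↔ z}`, `{z ↔ y₁}`, `{z ↔ y₂}` occur
disjointly (witnesses: the conditioned pairs of `C(x; Q_j)`; the edge `(x, x̃)` followed by an open
path in `C̃` to the triple point `z`; and the two remaining branches).
[cite: KozmaNachmias2011, proof of Lemma 5.2 ((i)–(ii), p. 405)] -/
theorem admissible_inter_subset_iUnion (x y₁ y₂ : Site d) :
    {ω | IsAdmissible p j L K x y₁ ω} ∩ {ω | IsAdmissible p j L K x y₂ ω} ∩
        {ω | regBoundaryConnCount d p j K ω = M} ⊆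
      ⋃ z : Site d, eventE1 p j K M x □
        disjointOccurrenceList [openConn x z, openConn z y₁, openConn z y₂] := by
  classical
  rintro ω ⟨⟨h₁, h₂⟩, hM⟩
  have hE1 : ω ∈ eventE1 p j K M x := mem_eventE1.2 ⟨h₁.2.2.2.1, h₁.2.2.2.2.2.1, hM⟩
  set e : Sym2 (Site d) := s(x, outerNeighbor j x) with he_def
  obtain ⟨he, -⟩ := h₁.edge_mem_and_not
  have hxne : x ≠ outerNeighbor j x := fun h => h₁.outerNeighbor_notMem_box (h ▸ sphere_subset_box d j h₁.1)
  obtain ⟨z, E₀, E₁, E₂, hE₀ω, hE₁ω, hE₂ω, hreach, hd₀₁, hd₀₂, hd₁₂, hc₀, hc₁, hc₂⟩ :=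
    exists_triple_witness h₁.reachable_outer_diff h₂.reachable_outer_diff
  refine Set.mem_iUnion.2 ⟨z, ?_⟩
  set W : Set (Sym2 (Site d)) := ↑(clusterPairs (box d j) (clusterIn (box d j) x ω)) with hW
  have key := mem_inter_disjointOccurrenceList_of_witnesses (E := eventE1 p j K M x) (ω := ω) (K₀ := W)
    (localCylinder_clusterPairs_subset_eventE1 hE1)
    [((openConn x z : Set (BondConfig (Site d))), (↑(insert e E₀) : Set (Sym2 (Site d)))),
      ((openConn z y₁ : Set (BondConfig (Site d))), (↑E₁ : Set (Sym2 (Site d)))),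
      ((openConn z y₂ : Set (BondConfig (Site d))), (↑E₂ : Set (Sym2 (Site d))))]
  simp only [List.map_cons, List.map_nil] at key
  -- endpoints of the witnesses avoid `C(x; Q_j)`
  have havoid : ∀ e' ∈ E₀ ∪ E₁ ∪ E₂, ∀ w ∈ e', w ∉ clusterIn (box d j) x ω :=
    fun e' he' w hw => h₁.notMem_clusterIn (hreach e' he' w hw)
  have hWdisj : ∀ E : Finset (Sym2 (Site d)), E ⊆ E₀ ∪ E₁ ∪ E₂ → Disjoint W ↑E := by
    intro E hE
    rw [hW, Finset.disjoint_coe, Finset.disjoint_right]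
    exact fun e' he' => notMem_clusterPairs_of_forall (havoid e' (hE he'))
  have heW : e ∉ W := fun h => h₁.edge_notMem_sym2 (Finset.sdiff_subset h)
  have heE : ∀ E : Finset (Sym2 (Site d)), (↑E : Set (Sym2 (Site d))) ⊆ ω \ {e} → e ∉ E :=
    fun E hE h => (hE h).2 rfl
  refine key ?_ ?_ ?_ ?_ ?_
  · intro q hq
    simp only [List.mem_cons, List.not_mem_nil, or_false] at hq
    rcases hq with rfl | rfl | rfl <;> exact isUpperSet_openConn _ _
  · intro q hq
    simp only [List.mem_cons, List.not_mem_nil, or_false] at hq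
    rcases hq with rfl | rfl | rfl
    · -- `{e} ∪ E₀` joins `x` to `z`
      show (↑(insert e E₀) : Set (Sym2 (Site d))) ∈ (openConn x z : Set (BondConfig (Site d)))
      have h1 : (openGraph (↑(insert e E₀) : Set (Sym2 (Site d)))).Adj x (outerNeighbor j x) :=
        (openGraph_adj _ _ _).2 ⟨by simp [he_def], hxne⟩
      exact h1.reachable.trans (hc₀.mono (openGraph_mono (by
        rw [Finset.coe_insert]; exact Set.subset_insert _ _)))
    · exact hc₁
    · exact hc₂
  · intro q hq
    simp only [List.mem_cons, List.not_mem_nil, or_false] at hq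
    rcases hq with rfl | rfl | rfl
    · show (↑(insert e E₀) : Set (Sym2 (Site d))) ⊆ ω
      rw [Finset.coe_insert]
      exact Set.insert_subset he (hE₀ω.trans Set.sdiff_subset)
    · exact hE₁ω.trans Set.sdiff_subset
    · exact hE₂ω.trans Set.sdiff_subset
  · refine List.pairwise_cons.2 ⟨fun q hq => ?_, List.pairwise_cons.2 ⟨fun q hq => ?_, List.pairwise_singleton _ _⟩⟩
    · simp only [List.mem_cons, List.not_mem_nil, or_false] at hq
      rcases hq with rfl | rfl
      · show Disjoint (↑(insert e E₀) : Set (Sym2 (Site d))) ↑E₁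
        rw [Finset.disjoint_coe, Finset.disjoint_insert_left]; exact ⟨heE E₁ hE₁ω, hd₀₁⟩
      · show Disjoint (↑(insert e E₀) : Set (Sym2 (Site d))) ↑E₂
        rw [Finset.disjoint_coe, Finset.disjoint_insert_left]; exact ⟨heE E₂ hE₂ω, hd₀₂⟩
    · simp only [List.mem_cons, List.not_mem_nil, or_false] at hq
      subst hq
      show Disjoint (↑E₁ : Set (Sym2 (Site d))) ↑E₂
      rw [Finset.disjoint_coe]; exact hd₁₂
  · intro q hq
    simp only [List.mem_cons, List.not_mem_nil, or_false] at hq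
    rcases hq with rfl | rfl | rfl
    · show Disjoint W ↑(insert e E₀)
      rw [Finset.coe_insert, Set.disjoint_insert_right]
      exact ⟨heW, hWdisj E₀ (Finset.subset_union_left.trans Finset.subset_union_left)⟩
    · exact hWdisj E₁ (Finset.subset_union_right.trans Finset.subset_union_left)
    · exact hWdisj E₂ Finset.subset_union_right

variable {p j L K}

/-- **`C̃₁ ∩ C̃₂ = ∅`** (Kozma–Nachmias 2011, p. 405: "if `z ∈ C̃₁ ∩ C̃₂`, then taking a simple open
path from `z` to `0` and examining which of the edges `(xᵢ, x̃ᵢ)` it passes first, it is clear that it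
does not need to pass through the other, contradicting the definition of `C̃ᵢ`"): for admissible
`(x₁, y₁)`, `(x₂, y₂)` with `x₁ ≠ x₂`, no vertex is joined both to `x̃₁` avoiding `(x₁, x̃₁)` and to
`x̃₂` avoiding `(x₂, x̃₂)`. [cite: KozmaNachmias2011, proof of Lemma 5.2 ((iii), p. 405)] -/
theorem IsAdmissible.not_reachable_both {x₁ y₁ x₂ y₂ : Site d} {ω : BondConfig (Site d)}
    (h₁ : IsAdmissible p j L K x₁ y₁ ω) (h₂ : IsAdmissible p j L K x₂ y₂ ω) (hne : x₁ ≠ x₂)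
    {v : Site d} (hv₁ : (openGraph (ω \ {s(x₁, outerNeighbor j x₁)})).Reachable (outerNeighbor j x₁) v)
    (hv₂ : (openGraph (ω \ {s(x₂, outerNeighbor j x₂)})).Reachable (outerNeighbor j x₂) v) : False := by
  set e₁ : Sym2 (Site d) := s(x₁, outerNeighbor j x₁) with he₁_def
  set e₂ : Sym2 (Site d) := s(x₂, outerNeighbor j x₂) with he₂_def
  obtain ⟨he₁, hnot₁⟩ := h₁.edge_mem_and_not
  obtain ⟨he₂, hnot₂⟩ := h₂.edge_mem_and_not
  have hw₁ := h₁.outerNeighbor_notMem_box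
  have hw₂ := h₂.outerNeighbor_notMem_box
  have hne₁₂ : e₁ ≠ e₂ := by
    intro h
    rcases Sym2.eq_iff.1 h with ⟨h, -⟩ | ⟨h, -⟩
    · exact hne h
    · exact hw₂ (h ▸ sphere_subset_box d j h₁.1)
  have hxw₁ : x₁ ≠ outerNeighbor j x₁ := fun h => hw₁ (h ▸ sphere_subset_box d j h₁.1)
  have hxw₂ : x₂ ≠ outerNeighbor j x₂ := fun h => hw₂ (h ▸ sphere_subset_box d j h₂.1)
  -- the configurations with one or both edges closed
  set ω₁ := ω \ {e₁} with hω₁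
  set ω₂ := ω \ {e₂} with hω₂
  set ω₁₂ := ω₂ \ {e₁} with hω₁₂
  have h₁₂₁ : ω₁₂ ⊆ ω₁ := Set.sdiff_subset_sdiff_left Set.sdiff_subset
  have h₁₂₂ : ω₁₂ ⊆ ω₂ := Set.sdiff_subset
  have he₁ω₂ : e₁ ∈ ω₂ := ⟨he₁, fun h => hne₁₂ (Set.mem_singleton_iff.1 h)⟩
  have he₂ω₁ : e₂ ∈ ω₁ := ⟨he₂, fun h => hne₁₂ (Set.mem_singleton_iff.1 h).symm⟩
  -- `0 ↔ xᵢ` in `ωᵢ` and cross versions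
  have h0x₁ : (openGraph ω₂).Reachable 0 x₁ :=
    reachable_diff_of_openConnIn h₁.2.2.2.1 fun e he => by
      rw [Set.mem_singleton_iff] at he; subst he
      exact ⟨outerNeighbor j x₂, Sym2.mem_mk_right _ _, fun h' => hw₂ (Finset.mem_coe.1 h')⟩
  have h0x₂ : (openGraph ω₁).Reachable 0 x₂ :=
    reachable_diff_of_openConnIn h₂.2.2.2.1 fun e he => by
      rw [Set.mem_singleton_iff] at he; subst he
      exact ⟨outerNeighbor j x₁, Sym2.mem_mk_right _ _, fun h' => hw₁ (Finset.mem_coe.1 h')⟩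
  have h0w₂ : (openGraph ω₁).Reachable 0 (outerNeighbor j x₂) :=
    h0x₂.trans ((openGraph_adj ω₁ _ _).2 ⟨he₂ω₁, hxw₂⟩).reachable
  have h0w₁ : (openGraph ω₂).Reachable 0 (outerNeighbor j x₁) :=
    h0x₁.trans ((openGraph_adj ω₂ _ _).2 ⟨he₁ω₂, hxw₁⟩).reachable
  have hy₁ : (openGraph ω₁).Reachable (outerNeighbor j x₁) y₁ := h₁.reachable_outer_diff
  have hy₂ : (openGraph ω₂).Reachable (outerNeighbor j x₂) y₂ := h₂.reachable_outer_diff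
  -- insert `e₁` into `ω₁₂` and analyse the path from `x̃₂` to `v`
  have hins : insert e₁ ω₁₂ = ω₂ := Set.insert_sdiff_self_of_mem he₁ω₂
  have hv₂' : (openGraph (insert e₁ ω₁₂)).Reachable (outerNeighbor j x₂) v := by rwa [hins]
  rcases reachable_insert_cases hv₂' with h | ⟨h, -⟩ | ⟨h, -⟩
  · -- `x̃₂ ↔ v` avoiding both: then `0 ↔ x̃₂ ↔ v ↔ x̃₁ ↔ y₁` avoiding `e₁`
    exact hnot₁ (((h0w₂.trans (h.mono (openGraph_mono h₁₂₁))).trans hv₁.symm).trans hy₁)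
  · -- `x̃₂ ↔ x₁` avoiding `e₂`: then `0 ↔ x₁ ↔ x̃₂ ↔ y₂` avoiding `e₂`
    exact hnot₂ ((h0x₁.trans (h.mono (openGraph_mono h₁₂₂)).symm).trans hy₂)
  · -- `x̃₂ ↔ x̃₁` avoiding `e₂`: then `0 ↔ x̃₁ ↔ x̃₂ ↔ y₂` avoiding `e₂`
    exact hnot₂ ((h0w₁.trans (h.mono (openGraph_mono h₁₂₂)).symm).trans hy₂)

variable (p j L K)

/-- **Case (iii)** (Kozma–Nachmias 2011, p. 405): if `(x₁, y₁)` and `(x₂, y₂)` are admissible with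
`x₁ ≠ x₂` and `X_j^{K-reg} = M`, then `{E₁(x₁), E₁(x₂)} ∘ {x₁ ↔ y₁} ∘ {x₂ ↔ y₂}` occurs (witnesses:
the conditioned pairs of `C(0; Q_j)`, and the edges `(xᵢ, x̃ᵢ)` followed by open paths inside the
disjoint clusters `C̃ᵢ`). [cite: KozmaNachmias2011, proof of Lemma 5.2 ((iii), p. 405)] -/
theorem admissible_inter_subset_of_ne {x₁ x₂ : Site d} (hne : x₁ ≠ x₂) (y₁ y₂ : Site d) :
    {ω | IsAdmissible p j L K x₁ y₁ ω} ∩ {ω | IsAdmissible p j L K x₂ y₂ ω} ∩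
        {ω | regBoundaryConnCount d p j K ω = M} ⊆
      (eventE1 p j K M x₁ ∩ eventE1 p j K M x₂) □
        disjointOccurrenceList [openConn x₁ y₁, openConn x₂ y₂] := by
  classical
  rintro ω ⟨⟨h₁, h₂⟩, hM⟩
  have hE1₁ : ω ∈ eventE1 p j K M x₁ := mem_eventE1.2 ⟨h₁.2.2.2.1, h₁.2.2.2.2.2.1, hM⟩
  have hE1₂ : ω ∈ eventE1 p j K M x₂ := mem_eventE1.2 ⟨h₂.2.2.2.1, h₂.2.2.2.2.2.1, hM⟩
  set e₁ : Sym2 (Site d) := s(x₁, outerNeighbor j x₁) with he₁_def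
  set e₂ : Sym2 (Site d) := s(x₂, outerNeighbor j x₂) with he₂_def
  obtain ⟨he₁, -⟩ := h₁.edge_mem_and_not
  obtain ⟨he₂, -⟩ := h₂.edge_mem_and_not
  have hxw₁ : x₁ ≠ outerNeighbor j x₁ := fun h => h₁.outerNeighbor_notMem_box (h ▸ sphere_subset_box d j h₁.1)
  have hxw₂ : x₂ ≠ outerNeighbor j x₂ := fun h => h₂.outerNeighbor_notMem_box (h ▸ sphere_subset_box d j h₂.1)
  -- the common cluster `C(x₁; Q_j) = C(x₂; Q_j) ∋ 0, x₁, x₂`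
  set A := clusterIn (box d j) x₁ ω with hA
  have hx₂A : x₂ ∈ A := by
    obtain ⟨h0, hx₁', hr₁⟩ := h₁.2.2.2.1
    obtain ⟨h0', hx₂', hr₂⟩ := h₂.2.2.2.1
    exact mem_clusterIn.2 ⟨hx₁', hx₂', hr₁.symm.trans hr₂⟩
  have hx₁A : x₁ ∈ A := self_mem_clusterIn (sphere_subset_box d j h₁.1) ω
  have hA₂ : clusterIn (box d j) x₂ ω = A := clusterIn_eq_of_mem_clusterIn hx₂A
  -- open witnesses inside `C̃₁`, `C̃₂`
  obtain ⟨F₁, hF₁ω, hF₁reach, hF₁conn⟩ := exists_finset_witness_openConn h₁.reachable_outer_diff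
  obtain ⟨F₂, hF₂ω, hF₂reach, hF₂conn⟩ := exists_finset_witness_openConn h₂.reachable_outer_diff
  have havoid₁ : ∀ e ∈ F₁, ∀ w ∈ e, w ∉ A := fun e he w hw => h₁.notMem_clusterIn (hF₁reach e he w hw)
  have havoid₂ : ∀ e ∈ F₂, ∀ w ∈ e, w ∉ A := fun e he w hw =>
    hA₂ ▸ h₂.notMem_clusterIn (hF₂reach e he w hw)
  set W : Set (Sym2 (Site d)) := ↑(clusterPairs (box d j) A) with hW
  have hK₀ : localCylinder W ω ⊆ eventE1 p j K M x₁ ∩ eventE1 p j K M x₂ := by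
    refine Set.subset_inter (localCylinder_clusterPairs_subset_eventE1 hE1₁) ?_
    have h := localCylinder_clusterPairs_subset_eventE1 hE1₂
    rw [hA₂] at h
    exact h
  have key := mem_inter_disjointOccurrenceList_of_witnesses (E := eventE1 p j K M x₁ ∩ eventE1 p j K M x₂)
    (ω := ω) (K₀ := W) hK₀
    [((openConn x₁ y₁ : Set (BondConfig (Site d))), (↑(insert e₁ F₁) : Set (Sym2 (Site d)))),
      ((openConn x₂ y₂ : Set (BondConfig (Site d))), (↑(insert e₂ F₂) : Set (Sym2 (Site d))))]
  simp only [List.map_cons, List.map_nil] at key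
  have hconn : ∀ {x y : Site d} {e : Sym2 (Site d)} {F : Finset (Sym2 (Site d))},
      e = s(x, outerNeighbor j x) → x ≠ outerNeighbor j x →
      (↑F : Set (Sym2 (Site d))) ∈ (openConn (outerNeighbor j x) y : Set (BondConfig (Site d))) →
      (↑(insert e F) : Set (Sym2 (Site d))) ∈ (openConn x y : Set (BondConfig (Site d))) := by
    intro x y e F he hxne hF
    have h1 : (openGraph (↑(insert e F) : Set (Sym2 (Site d)))).Adj x (outerNeighbor j x) :=
      (openGraph_adj _ _ _).2 ⟨by simp [he], hxne⟩
    exact h1.reachable.trans (hF.mono (openGraph_mono (by rw [Finset.coe_insert]; exact Set.subset_insert _ _)))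
  refine key ?_ ?_ ?_ ?_ ?_
  · intro q hq
    simp only [List.mem_cons, List.not_mem_nil, or_false] at hq
    rcases hq with rfl | rfl <;> exact isUpperSet_openConn _ _
  · intro q hq
    simp only [List.mem_cons, List.not_mem_nil, or_false] at hq
    rcases hq with rfl | rfl
    · exact hconn he₁_def hxw₁ hF₁conn
    · exact hconn he₂_def hxw₂ hF₂conn
  · intro q hq
    simp only [List.mem_cons, List.not_mem_nil, or_false] at hq
    rcases hq with rfl | rfl
    · show (↑(insert e₁ F₁) : Set (Sym2 (Site d))) ⊆ ω
      rw [Finset.coe_insert]; exact Set.insert_subset he₁ (hF₁ω.trans Set.sdiff_subset)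
    · show (↑(insert e₂ F₂) : Set (Sym2 (Site d))) ⊆ ω
      rw [Finset.coe_insert]; exact Set.insert_subset he₂ (hF₂ω.trans Set.sdiff_subset)
  · refine List.pairwise_cons.2 ⟨fun q hq => ?_, List.pairwise_singleton _ _⟩
    simp only [List.mem_cons, List.not_mem_nil, or_false] at hq
    subst hq
    show Disjoint (↑(insert e₁ F₁) : Set (Sym2 (Site d))) ↑(insert e₂ F₂)
    -- `{e₁} ∪ F₁` and `{e₂} ∪ F₂` are disjoint
    rw [Finset.disjoint_coe, Finset.disjoint_left]
    intro e he he'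
    rcases Finset.mem_insert.1 he with rfl | heF₁
    · rcases Finset.mem_insert.1 he' with h | heF₂
      · -- `e₁ = e₂`
        rcases Sym2.eq_iff.1 h with ⟨h, -⟩ | ⟨h, -⟩
        · exact hne h
        · exact h₂.outerNeighbor_notMem_box (h ▸ sphere_subset_box d j h₁.1)
      · exact havoid₂ _ heF₂ x₁ (Sym2.mem_mk_left _ _) hx₁A
    · rcases Finset.mem_insert.1 he' with rfl | heF₂
      · exact havoid₁ _ heF₁ x₂ (Sym2.mem_mk_left _ _) hx₂A
      · -- a common edge of `F₁` and `F₂` has an endpoint in `C̃₁ ∩ C̃₂`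
        induction e using Sym2.ind with
        | h a b =>
          exact h₁.not_reachable_both h₂ hne (hF₁reach _ heF₁ a (Sym2.mem_mk_left _ _))
            (hF₂reach _ heF₂ a (Sym2.mem_mk_left _ _))
  · intro q hq
    simp only [List.mem_cons, List.not_mem_nil, or_false] at hq
    have hWF : ∀ {x : Site d} {e : Sym2 (Site d)} {F : Finset (Sym2 (Site d))},
        e ∉ (box d j).sym2 → (∀ e' ∈ F, ∀ w ∈ e', w ∉ A) → Disjoint W (↑(insert e F) : Set (Sym2 (Site d))) := by
      intro x e F he hF
      rw [Finset.coe_insert, Set.disjoint_insert_right, hW, Finset.disjoint_coe, Finset.disjoint_right]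
      exact ⟨fun h => he (Finset.sdiff_subset h), fun e' he' => notMem_clusterPairs_of_forall (hF e' he')⟩
    rcases hq with rfl | rfl
    · exact hWF (x := x₁) h₁.edge_notMem_sym2 havoid₁
    · exact hWF (x := x₂) h₂.edge_notMem_sym2 havoid₂

end Trichotomy

/-! ### The probabilities: BK–Reimer and the sums `S₁ + S₂`, `S₃` -/

section Sums

variable {d : ℕ} (p : unitInterval) (j L K M : ℕ)

/-- **Case (iii), probability** (Kozma–Nachmias 2011, p. 405, the summand of `S₃`): for `x₁ ≠ x₂`,
`P((x₁,y₁), (x₂,y₂) admissible, X^{reg} = M) ≤ P(E₁(x₁) ∩ E₁(x₂)) τ(x₁,y₁) τ(x₂,y₂)`, by the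
BK–Reimer inequality (`reimer_local_finitary_list`). [cite: KozmaNachmias2011, proof of Lemma 5.2 (S₃, p. 405)] -/
theorem real_admissible_inter_le_of_ne {x₁ x₂ : Site d} (hne : x₁ ≠ x₂) (y₁ y₂ : Site d) :
    (bondPercolation (zdGraph d) p).real
        ({ω | IsAdmissible p j L K x₁ y₁ ω} ∩ {ω | IsAdmissible p j L K x₂ y₂ ω} ∩
          {ω | regBoundaryConnCount d p j K ω = M}) ≤
      (bondPercolation (zdGraph d) p).real (eventE1 p j K M x₁ ∩ eventE1 p j K M x₂) *
        tau d p x₁ y₁ * tau d p x₂ y₂ := by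
  classical
  have h := reimer_local_finitary_list (zdGraph d) p
    ((isLocalEvent_eventE1 p j K M x₁).inter_isLocalEvent (isLocalEvent_eventE1 p j K M x₂))
    isUpperSet_univ isFinitary_univ [openConn x₁ y₁, openConn x₂ y₂]
    (by intro D hD; simp only [List.mem_cons, List.not_mem_nil, or_false] at hD
        rcases hD with rfl | rfl <;> exact isUpperSet_openConn _ _)
    (by intro D hD; simp only [List.mem_cons, List.not_mem_nil, or_false] at hD
        rcases hD with rfl | rfl <;> exact isFinitary_openConn _ _)
  rw [Set.inter_univ] at h
  simp only [List.map_cons, List.map_nil, List.prod_cons, List.prod_nil, mul_one] at h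
  calc _ ≤ (bondPercolation (zdGraph d) p).real ((eventE1 p j K M x₁ ∩ eventE1 p j K M x₂) □
          disjointOccurrenceList [openConn x₁ y₁, openConn x₂ y₂]) :=
        measureReal_mono (admissible_inter_subset_of_ne p j L K M hne y₁ y₂)
    _ ≤ _ := h
    _ = _ := by rw [tau, tau, mul_assoc]

/-- **Cases (i)–(ii), probability, truncated at the branch points in `Λ_N`** (the summand of
`S₁ + S₂`, p. 405): `P(⋃_{z ∈ Λ_N} E₁(x) ∘ {x ↔ z} ∘ {z ↔ y₁} ∘ {z ↔ y₂}) ≤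
P(E₁(x)) Σ_{z ∈ Λ_N} τ(x,z) τ(z,y₁) τ(z,y₂)`. [cite: KozmaNachmias2011, proof of Lemma 5.2 (S₁, S₂, p. 405)] -/
theorem real_biUnion_le_sum (x y₁ y₂ : Site d) (N : ℕ) :
    (bondPercolation (zdGraph d) p).real (⋃ z ∈ box d N, eventE1 p j K M x □
        disjointOccurrenceList [openConn x z, openConn z y₁, openConn z y₂]) ≤
      (bondPercolation (zdGraph d) p).real (eventE1 p j K M x) *
        ∑ z ∈ box d N, tau d p x z * (tau d p z y₁ * tau d p z y₂) := by
  classical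
  rw [Finset.mul_sum]
  refine (measureReal_biUnion_finset_le _ _).trans (Finset.sum_le_sum fun z _ => ?_)
  have h := reimer_local_finitary_list (zdGraph d) p (isLocalEvent_eventE1 p j K M x)
    isUpperSet_univ isFinitary_univ [openConn x z, openConn z y₁, openConn z y₂]
    (by intro D hD; simp only [List.mem_cons, List.not_mem_nil, or_false] at hD
        rcases hD with rfl | rfl | rfl <;> exact isUpperSet_openConn _ _)
    (by intro D hD; simp only [List.mem_cons, List.not_mem_nil, or_false] at hD
        rcases hD with rfl | rfl | rfl <;> exact isFinitary_openConn _ _)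
  rw [Set.inter_univ] at h
  simp only [List.map_cons, List.map_nil, List.prod_cons, List.prod_nil, mul_one] at h
  calc _ ≤ _ := h
    _ = _ := by rw [tau, tau, tau]

/-- The truncations increase to the event of cases (i)–(ii), whose probability is therefore the
limit. [folklore] -/
theorem tendsto_real_biUnion (x y₁ y₂ : Site d) :
    Tendsto (fun N : ℕ => (bondPercolation (zdGraph d) p).real (⋃ z ∈ box d N, eventE1 p j K M x □
        disjointOccurrenceList [openConn x z, openConn z y₁, openConn z y₂])) atTop
      (𝓝 ((bondPercolation (zdGraph d) p).real (⋃ z : Site d, eventE1 p j K M x □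
        disjointOccurrenceList [openConn x z, openConn z y₁, openConn z y₂]))) := by
  set S : Site d → Set (BondConfig (Site d)) := fun z => eventE1 p j K M x □
    disjointOccurrenceList [openConn x z, openConn z y₁, openConn z y₂] with hS
  have hmono : Monotone fun N : ℕ => ⋃ z ∈ box d N, S z := fun N N' h =>
    Set.biUnion_subset_biUnion_left fun z hz => box_mono d h hz
  have hU : (⋃ N : ℕ, ⋃ z ∈ box d N, S z) = ⋃ z, S z := by
    ext ω
    simp only [Set.mem_iUnion, exists_prop]
    exact ⟨fun ⟨_, z, _, hz⟩ => ⟨z, hz⟩, fun ⟨z, hz⟩ =>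
      ⟨Site.supNorm z, z, mem_box_iff_supNorm_le.2 le_rfl, hz⟩⟩
  have h := tendsto_measure_iUnion_atTop (μ := bondPercolation (zdGraph d) p) hmono
  rw [hU] at h
  exact (ENNReal.tendsto_toReal (measure_ne_top _ _)).comp h

/-- **Kozma–Nachmias 2011, Lemma 5.2, summed form, PROVED** for every `p` under the upper two-point
bound `τ_p(x,y) ≤ C/‖x-y‖^{d-2}` on `ℤ^d`, `d ≥ 4`: there is `C₂ = C₂(d, C)` such that for all
`j, K, L, M` with `L ≥ 1` and `L² ≤ 2M`,
`Σ_{(x₁,y₁),(x₂,y₂)} P((x₁,y₁), (x₂,y₂) are (j,L,K)-admissible, X_j^{K-reg} = M) ≤ C₂ M² L⁴ P(X_j^{K-reg} = M)`,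
the pairs ranging over `xᵢ ∈ ∂Q_j`, `yᵢ ∈ xᵢ + Q_L` (p. 405: `E Y² 1_{X^{reg}=M} ≤ S₁ + S₂ + S₃`,
`S₁ ≤ C M L²`, `S₂ ≤ C M L⁶`, `S₃ ≤ C M² L⁴`, "since `M ≥ L²/2`").
[cite: KozmaNachmias2011, Lemma 5.2 (p. 398; proof pp. 405–406)] -/
theorem KozmaNachmias2011_lemma52_sum (hd : 4 ≤ d) {C : ℝ} (hC : 0 ≤ C)
    (hU : ∀ x y : Site d, x ≠ y → tau d p x y ≤ C * (‖x - y‖ ^ (d - 2))⁻¹) :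
    ∃ C₂ : ℝ, 0 < C₂ ∧ ∀ (j K L M : ℕ), 1 ≤ L → (L : ℝ) ^ 2 ≤ 2 * M →
      ∑ q₁ ∈ sphere d j ×ˢ box d L, ∑ q₂ ∈ sphere d j ×ˢ box d L,
        (bondPercolation (zdGraph d) p).real
          ({ω | IsAdmissible p j L K q₁.1 (q₁.1 + q₁.2) ω} ∩
            {ω | IsAdmissible p j L K q₂.1 (q₂.1 + q₂.2) ω} ∩
            {ω | regBoundaryConnCount d p j K ω = M}) ≤
        C₂ * (M : ℝ) ^ 2 * (L : ℝ) ^ 4 *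
          (bondPercolation (zdGraph d) p).real {ω | regBoundaryConnCount d p j K ω = M} := by
  classical
  have hd2 : 2 ≤ d := by omega
  obtain ⟨C₀, hC₀, hbox⟩ := exists_sum_tau_box_le p hd2 hC hU
  obtain ⟨C₁, hC₁, hsq⟩ := exists_sum_tau_mul_sq_le p hd hC hU
  refine ⟨2 * C₁ + C₀ ^ 2, by positivity, fun j K L M hL hLM => ?_⟩
  set μ := bondPercolation (zdGraph d) p with hμ
  set F : Set (BondConfig (Site d)) := {ω | regBoundaryConnCount d p j K ω = M} with hF
  set Adm : Site d × Site d → Set (BondConfig (Site d)) :=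
    fun q => {ω | IsAdmissible p j L K q.1 (q.1 + q.2) ω} with hAdm
  set f : Site d × Site d → Site d × Site d → ℝ := fun q₁ q₂ => μ.real (Adm q₁ ∩ Adm q₂ ∩ F) with hf
  have hf0 : ∀ q₁ q₂, 0 ≤ f q₁ q₂ := fun _ _ => measureReal_nonneg
  set I := sphere d j ×ˢ box d L with hI
  have hPF : 0 ≤ μ.real F := measureReal_nonneg
  have hM0 : (0 : ℝ) ≤ M := Nat.cast_nonneg M
  -- split according to `x₁ = x₂`
  have hsplit : ∀ q₁ ∈ I, ∑ q₂ ∈ I, f q₁ q₂ =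
      ∑ q₂ ∈ I.filter (fun q₂ => q₂.1 = q₁.1), f q₁ q₂ + ∑ q₂ ∈ I.filter (fun q₂ => ¬q₂.1 = q₁.1), f q₁ q₂ :=
    fun q₁ _ => (Finset.sum_filter_add_sum_filter_not I (fun q₂ => q₂.1 = q₁.1) _).symm
  rw [Finset.sum_congr rfl hsplit, Finset.sum_add_distrib]
  -- (A): `x₁ = x₂`
  have hA : ∑ q₁ ∈ I, ∑ q₂ ∈ I.filter (fun q₂ => q₂.1 = q₁.1), f q₁ q₂ ≤ C₁ * (L : ℝ) ^ 6 * (M * μ.real F) := by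
    -- reindex the inner sum by `w₂ ∈ Q_L`
    have hre : ∀ q₁ ∈ I, ∑ q₂ ∈ I.filter (fun q₂ => q₂.1 = q₁.1), f q₁ q₂ =
        ∑ w₂ ∈ box d L, f q₁ (q₁.1, w₂) := by
      intro q₁ hq₁
      have hx₁ : q₁.1 ∈ sphere d j := (Finset.mem_product.1 hq₁).1
      have : I.filter (fun q₂ => q₂.1 = q₁.1) = (box d L).map ⟨fun w => (q₁.1, w), fun a b h => (Prod.mk.inj h).2⟩ := by
        ext q
        simp only [hI, Finset.mem_filter, Finset.mem_product, Finset.mem_map, Function.Embedding.coeFn_mk]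
        constructor
        · rintro ⟨⟨-, hw⟩, hx⟩; exact ⟨q.2, hw, by rw [← hx]⟩
        · rintro ⟨w, hw, rfl⟩; exact ⟨⟨hx₁, hw⟩, rfl⟩
      rw [this, Finset.sum_map]
      rfl
    rw [Finset.sum_congr rfl hre, hI, Finset.sum_product]
    -- the limit `N → ∞` of the truncated bounds
    set U : Site d → Site d → Site d → ℕ → Set (BondConfig (Site d)) := fun x w₁ w₂ N =>
      ⋃ z ∈ box d N, eventE1 p j K M x □
        disjointOccurrenceList [openConn x z, openConn z (x + w₁), openConn z (x + w₂)] with hUdef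
    have hlim : Tendsto (fun N => ∑ x ∈ sphere d j, ∑ w₁ ∈ box d L, ∑ w₂ ∈ box d L, μ.real (U x w₁ w₂ N))
        atTop (𝓝 (∑ x ∈ sphere d j, ∑ w₁ ∈ box d L, ∑ w₂ ∈ box d L,
          μ.real (⋃ z : Site d, eventE1 p j K M x □
            disjointOccurrenceList [openConn x z, openConn z (x + w₁), openConn z (x + w₂)]))) :=
      tendsto_finsetSum _ fun x _ => tendsto_finsetSum _ fun w₁ _ => tendsto_finsetSum _ fun w₂ _ =>
        tendsto_real_biUnion p j K M x (x + w₁) (x + w₂)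
    have hswap : ∀ (x : Site d) (N : ℕ),
        ∑ w₁ ∈ box d L, ∑ w₂ ∈ box d L, μ.real (eventE1 p j K M x) *
            ∑ z ∈ box d N, tau d p x z * (tau d p z (x + w₁) * tau d p z (x + w₂)) =
          μ.real (eventE1 p j K M x) * ∑ z ∈ box d N, tau d p x z * (∑ w ∈ box d L, tau d p z (x + w)) ^ 2 := by
      intro x N
      have h1 : ∑ w₁ ∈ box d L, ∑ w₂ ∈ box d L, μ.real (eventE1 p j K M x) *
            ∑ z ∈ box d N, tau d p x z * (tau d p z (x + w₁) * tau d p z (x + w₂)) =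
          μ.real (eventE1 p j K M x) * ∑ w₁ ∈ box d L, ∑ w₂ ∈ box d L,
            ∑ z ∈ box d N, tau d p x z * (tau d p z (x + w₁) * tau d p z (x + w₂)) := by
        rw [Finset.mul_sum]
        exact Finset.sum_congr rfl fun w₁ _ => by rw [Finset.mul_sum]
      rw [h1]
      congr 1
      symm
      calc ∑ z ∈ box d N, tau d p x z * (∑ w ∈ box d L, tau d p z (x + w)) ^ 2
          = ∑ z ∈ box d N, ∑ w₁ ∈ box d L, ∑ w₂ ∈ box d L,
              tau d p x z * (tau d p z (x + w₁) * tau d p z (x + w₂)) := by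
            refine Finset.sum_congr rfl fun z _ => ?_
            rw [sq, Finset.sum_mul_sum, Finset.mul_sum]
            exact Finset.sum_congr rfl fun w₁ _ => by rw [Finset.mul_sum]
        _ = ∑ w₁ ∈ box d L, ∑ z ∈ box d N, ∑ w₂ ∈ box d L,
              tau d p x z * (tau d p z (x + w₁) * tau d p z (x + w₂)) := Finset.sum_comm
        _ = ∑ w₁ ∈ box d L, ∑ w₂ ∈ box d L, ∑ z ∈ box d N,
              tau d p x z * (tau d p z (x + w₁) * tau d p z (x + w₂)) :=
            Finset.sum_congr rfl fun w₁ _ => Finset.sum_comm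
    have hbd : ∀ N, ∑ x ∈ sphere d j, ∑ w₁ ∈ box d L, ∑ w₂ ∈ box d L, μ.real (U x w₁ w₂ N) ≤
        C₁ * (L : ℝ) ^ 6 * (M * μ.real F) := by
      intro N
      calc ∑ x ∈ sphere d j, ∑ w₁ ∈ box d L, ∑ w₂ ∈ box d L, μ.real (U x w₁ w₂ N)
          ≤ ∑ x ∈ sphere d j, ∑ w₁ ∈ box d L, ∑ w₂ ∈ box d L, μ.real (eventE1 p j K M x) *
              ∑ z ∈ box d N, tau d p x z * (tau d p z (x + w₁) * tau d p z (x + w₂)) :=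
            Finset.sum_le_sum fun x _ => Finset.sum_le_sum fun w₁ _ => Finset.sum_le_sum fun w₂ _ =>
              real_biUnion_le_sum p j K M x (x + w₁) (x + w₂) N
        _ = ∑ x ∈ sphere d j, μ.real (eventE1 p j K M x) *
              ∑ z ∈ box d N, tau d p x z * (∑ w ∈ box d L, tau d p z (x + w)) ^ 2 :=
            Finset.sum_congr rfl fun x _ => hswap x N
        _ ≤ ∑ x ∈ sphere d j, μ.real (eventE1 p j K M x) * (C₁ * (L : ℝ) ^ 6) :=
            Finset.sum_le_sum fun x _ => mul_le_mul_of_nonneg_left (hsq x (box d N) L hL) measureReal_nonneg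
        _ = C₁ * (L : ℝ) ^ 6 * (M * μ.real F) := by
            rw [← Finset.sum_mul, sum_real_eventE1, mul_comm]
    have hle := le_of_tendsto' hlim hbd
    refine le_trans (Finset.sum_le_sum fun x _ => Finset.sum_le_sum fun w₁ _ =>
      Finset.sum_le_sum fun w₂ _ => ?_) hle
    exact measureReal_mono (admissible_inter_subset_iUnion p j L K M x (x + w₁) (x + w₂))
  -- (B): `x₁ ≠ x₂`
  have hB : ∑ q₁ ∈ I, ∑ q₂ ∈ I.filter (fun q₂ => ¬q₂.1 = q₁.1), f q₁ q₂ ≤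
      C₀ ^ 2 * (L : ℝ) ^ 4 * ((M : ℝ) ^ 2 * μ.real F) := by
    calc ∑ q₁ ∈ I, ∑ q₂ ∈ I.filter (fun q₂ => ¬q₂.1 = q₁.1), f q₁ q₂
        ≤ ∑ q₁ ∈ I, ∑ q₂ ∈ I.filter (fun q₂ => ¬q₂.1 = q₁.1),
            μ.real (eventE1 p j K M q₁.1 ∩ eventE1 p j K M q₂.1) *
              tau d p q₁.1 (q₁.1 + q₁.2) * tau d p q₂.1 (q₂.1 + q₂.2) := by
          refine Finset.sum_le_sum fun q₁ _ => Finset.sum_le_sum fun q₂ hq₂ => ?_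
          have hne : q₁.1 ≠ q₂.1 := fun h => (Finset.mem_filter.1 hq₂).2 h.symm
          exact real_admissible_inter_le_of_ne p j L K M hne _ _
      _ ≤ ∑ q₁ ∈ I, ∑ q₂ ∈ I,
            μ.real (eventE1 p j K M q₁.1 ∩ eventE1 p j K M q₂.1) *
              tau d p q₁.1 (q₁.1 + q₁.2) * tau d p q₂.1 (q₂.1 + q₂.2) :=
          Finset.sum_le_sum fun q₁ _ => Finset.sum_le_sum_of_subset_of_nonneg (Finset.filter_subset _ _)
            fun q₂ _ _ => mul_nonneg (mul_nonneg measureReal_nonneg (tau_nonneg p _ _)) (tau_nonneg p _ _)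
      _ = ∑ x₁ ∈ sphere d j, ∑ x₂ ∈ sphere d j, μ.real (eventE1 p j K M x₁ ∩ eventE1 p j K M x₂) *
            ((∑ w₁ ∈ box d L, tau d p x₁ (x₁ + w₁)) * (∑ w₂ ∈ box d L, tau d p x₂ (x₂ + w₂))) := by
          rw [hI, Finset.sum_product]
          refine Finset.sum_congr rfl fun x₁ _ => ?_
          rw [Finset.sum_comm, Finset.sum_product]
          refine Finset.sum_congr rfl fun x₂ _ => ?_
          rw [Finset.sum_mul_sum, Finset.mul_sum, Finset.sum_comm]
          refine Finset.sum_congr rfl fun w₁ _ => ?_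
          rw [Finset.mul_sum]
          refine Finset.sum_congr rfl fun w₂ _ => ?_
          ring
      _ ≤ ∑ x₁ ∈ sphere d j, ∑ x₂ ∈ sphere d j, μ.real (eventE1 p j K M x₁ ∩ eventE1 p j K M x₂) *
            ((C₀ * (L : ℝ) ^ 2) * (C₀ * (L : ℝ) ^ 2)) := by
          refine Finset.sum_le_sum fun x₁ _ => Finset.sum_le_sum fun x₂ _ =>
            mul_le_mul_of_nonneg_left ?_ measureReal_nonneg
          exact mul_le_mul (hbox x₁ x₁ L hL) (hbox x₂ x₂ L hL)
            (Finset.sum_nonneg fun w _ => tau_nonneg p _ _) (by positivity)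
      _ = C₀ ^ 2 * (L : ℝ) ^ 4 * ((M : ℝ) ^ 2 * μ.real F) := by
          have hsm : ∀ x₁ ∈ sphere d j, ∑ x₂ ∈ sphere d j, μ.real (eventE1 p j K M x₁ ∩ eventE1 p j K M x₂) *
              ((C₀ * (L : ℝ) ^ 2) * (C₀ * (L : ℝ) ^ 2)) =
              (∑ x₂ ∈ sphere d j, μ.real (eventE1 p j K M x₁ ∩ eventE1 p j K M x₂)) *
                ((C₀ * (L : ℝ) ^ 2) * (C₀ * (L : ℝ) ^ 2)) :=
            fun x₁ _ => (Finset.sum_mul _ _ _).symm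
          rw [Finset.sum_congr rfl hsm, ← Finset.sum_mul, sum_sum_real_eventE1_inter_eventE1]
          ring
  -- combine, using `L² ≤ 2M`
  have hL0 : (0 : ℝ) ≤ L := Nat.cast_nonneg L
  calc _ ≤ C₁ * (L : ℝ) ^ 6 * (M * μ.real F) + C₀ ^ 2 * (L : ℝ) ^ 4 * ((M : ℝ) ^ 2 * μ.real F) :=
        add_le_add hA hB
    _ ≤ C₁ * ((L : ℝ) ^ 4 * (2 * M)) * (M * μ.real F) + C₀ ^ 2 * (L : ℝ) ^ 4 * ((M : ℝ) ^ 2 * μ.real F) := by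
        gcongr
        calc (L : ℝ) ^ 6 = (L : ℝ) ^ 4 * (L : ℝ) ^ 2 := by ring
          _ ≤ (L : ℝ) ^ 4 * (2 * M) := mul_le_mul_of_nonneg_left hLM (by positivity)
    _ = (2 * C₁ + C₀ ^ 2) * (M : ℝ) ^ 2 * (L : ℝ) ^ 4 * μ.real F := by ring

/-- **Kozma–Nachmias 2011, Lemma 5.2 at `p_c`** under the hypotheses of the conditional Thm. 1
(`d > 6`, `TwoPointBoundedRatio d`). [cite: KozmaNachmias2011, Lemma 5.2 (p. 398)] -/
theorem KozmaNachmias2011_lemma52 (hd : 6 < d) (hτ : TwoPointBoundedRatio d) :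
    ∃ C₂ : ℝ, 0 < C₂ ∧ ∀ (j K L M : ℕ), 1 ≤ L → (L : ℝ) ^ 2 ≤ 2 * M →
      ∑ q₁ ∈ sphere d j ×ˢ box d L, ∑ q₂ ∈ sphere d j ×ˢ box d L,
        (bondPercolation (zdGraph d) (criticalProbI d)).real
          ({ω | IsAdmissible (criticalProbI d) j L K q₁.1 (q₁.1 + q₁.2) ω} ∩
            {ω | IsAdmissible (criticalProbI d) j L K q₂.1 (q₂.1 + q₂.2) ω} ∩
            {ω | regBoundaryConnCount d (criticalProbI d) j K ω = M}) ≤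
        C₂ * (M : ℝ) ^ 2 * (L : ℝ) ^ 4 *
          (bondPercolation (zdGraph d) (criticalProbI d)).real
            {ω | regBoundaryConnCount d (criticalProbI d) j K ω = M} := by
  obtain ⟨C', C, hC', hC'C, hb⟩ := hτ.natPow (by omega)
  exact KozmaNachmias2011_lemma52_sum (criticalProbI d) (by omega) (hC'.le.trans hC'C)
    fun x y hxy => (hb x y hxy).2

end Sums

end Literature.Barriers.CriticalPhenomena

end
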